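import Mathlib.Analysis.Calculus.Deriv.MeanValue
import Mathlib.Analysis.SpecialFunctions.ExpDeriv
import Literature.Barriers.AtomisticToContinuum.ShockFormationEnergyIdentity
import HarnessLib

/-!
# Sideris 1985, Theorem 1 — the integral identities (2.1 a–c)

Support file 5 for the discharge of
`Literature.Barriers.AtomisticToContinuum.ShockFormationBarrier` (Sideris, Comm. Math. Phys.
101 (1985), Thm. 1). For a `C¹` solution `(ρ, u, S)` of the polytropic Euler system (1.1 a–d) on
`[0, ∞) × ℝ³` which equals the rest state `(ρ̄, 0, S̄)` for `‖x‖ ≥ R + σ t` (the conclusion of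
Sideris' Proposition, `PolytropicEuler.FinitePropagationSpeed`), Sideris' averaged quantities
(1.4 a–c) satisfy (§2, p. 479, "using the proposition and integration by parts"):

* (2.1a) `m(t) = m(0)` (`massExcess_eq`): `∂ₜ(ρ - ρ̄) = -div (ρu)` integrates to zero;
* (2.1b) `η(t) = η(0)` (`entropyMassExcess_eq`): `∂ₜ(ρ e^{S/γ}) = -div (ρ e^{S/γ} u)`;
* (2.1c) `F'(t) = ∫ (ρ ‖u‖² + 3 (p - p̄)) dx` (`hasDerivAt_radialMomentum`):
  `∂ₜ(ρ ⟪x, u⟫) = -div(ρu) ⟪x, u⟫ - ρ ⟪x, (u·∇)u⟫ - ⟪x, ∇p⟫`, then `∫ ⟪x, u⟫ div(ρu) =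
  -∫ (ρ‖u‖² + ρ⟪x, (u·∇)u⟫)` and `∫ ⟪x, ∇(p - p̄)⟫ = -3 ∫ (p - p̄)` (no boundary terms: all
  fields are compactly supported perturbations of the rest state),

together with the continuity of `t ↦ F(t)` on `[0, ∞)`. Differentiation under the integral sign
and the whole-space integrations by parts are the tree's `hasDerivAt_integral_of_contDiffOn`,
`continuousOn_integral_of_support_subset`, `integral_divergence_eq_zero`,
`integral_mul_divergence_add_eq_zero_left/right`.

## Mathlib search

`exists_hasDerivAt_eq_slope` (constancy from a vanishing derivative), `fderiv_inner_apply`,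
`LinearMap.trace_id` (`div x = 3`). No definitions in this file.

## References

* T. C. Sideris, Comm. Math. Phys. 101 (1985) 475–485, (1.4 a–c), §2 (2.1 a–c) p. 479.
-/

noncomputable section

open Set Function Filter MeasureTheory Metric
open scoped RealInnerProductSpace Topology

namespace Literature.Barriers.AtomisticToContinuum.PolytropicEuler

open Literature.Analysis.FluidPDE Literature.Analysis.FluidPDE.VectorCalculus

section Identities

variable {A γ R σ ρbar Sbar : ℝ} {ρ : ℝ → E3 → ℝ} {u : ℝ → E3 → E3} {S : ℝ → E3 → ℝ}

/-- A function on `[0, ∞)` which is continuous on each `[0, T]` and has zero derivative on each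
`(0, T)` is constant (Lagrange's mean value theorem). [folklore] -/
theorem eq_of_hasDerivAt_zero {f : ℝ → ℝ} (hc : ∀ T, 0 < T → ContinuousOn f (Icc 0 T))
    (hd : ∀ T t, 0 < t → t < T → HasDerivAt f 0 t) {T : ℝ} (hT : 0 ≤ T) : f T = f 0 := by
  rcases hT.lt_or_eq with hpos | hzero
  · obtain ⟨c, hc', hslope⟩ := exists_hasDerivAt_eq_slope f (fun _ => (0 : ℝ)) hpos (hc T hpos)
      (fun t ht => hd T t ht.1 ht.2)
    have : f T - f 0 = 0 := by
      have h := hslope.symm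
      rw [div_eq_zero_iff] at h
      rcases h with h | h
      · exact h
      · linarith
    linarith
  · rw [← hzero]

/-- Outside the closed ball of radius `R + σ T` every slice `t ∈ [0, T]` of a field at rest beyond
the front is at rest (`σ ≥ 0`). [folklore] -/
theorem rest_of_notMem_closedBall (hσ : 0 ≤ σ)
    (hrest : ∀ t, 0 ≤ t → ∀ x : E3, R + σ * t ≤ ‖x‖ → ρ t x = ρbar ∧ u t x = 0 ∧ S t x = Sbar)
    {T t : ℝ} (ht : 0 ≤ t) (htT : t ≤ T) {x : E3} (hx : x ∉ closedBall (0 : E3) (R + σ * T)) :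
    ρ t x = ρbar ∧ u t x = 0 ∧ S t x = Sbar := by
  rw [mem_closedBall, dist_zero_right, not_le] at hx
  exact hrest t ht x (by nlinarith)

/-! ### (2.1a) conservation of the mass excess -/

/-- **(2.1a)** `m(t) = m(0)`: the mass excess `∫ (ρ - ρ̄)` of a `C¹` solution at rest beyond the
front `‖x‖ = R + σ t` is conserved (`∂ₜρ = -div(ρu)` and `∫ div(ρu) = 0`). [cite: Sideris1985, (2.1a)] -/
theorem massExcess_eq (h : IsPolytropicC1Solution A γ (Ici 0) ρ u S) (hσ : 0 ≤ σ)
    (hrest : ∀ t, 0 ≤ t → ∀ x : E3, R + σ * t ≤ ‖x‖ → ρ t x = ρbar ∧ u t x = 0 ∧ S t x = Sbar)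
    {t : ℝ} (ht : 0 ≤ t) : massExcess ρbar ρ t = massExcess ρbar ρ 0 := by
  have hΦ : ContDiffOn ℝ 1 (uncurry fun s (x : E3) => ρ s x - ρbar) (Ici 0 ×ˢ univ) :=
    h.contDiffOn_density.sub contDiffOn_const
  have hzero : ∀ T s, 0 ≤ s → s ≤ T → ∀ x ∉ closedBall (0 : E3) (R + σ * T), ρ s x - ρbar = 0 :=
    fun T s hs hsT x hx => by rw [(rest_of_notMem_closedBall hσ hrest hs hsT hx).1, sub_self]
  refine eq_of_hasDerivAt_zero (f := massExcess ρbar ρ) (fun T hT => ?_) (fun T s hs hsT => ?_) ht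
  · exact continuousOn_integral_of_support_subset (μ := volume) (isCompact_closedBall 0 (R + σ * T))
      (hΦ.continuousOn.mono (prod_mono Icc_subset_Ici_self Subset.rfl))
      fun s hs x hx => hzero T s hs.1 hs.2 x hx
  · have hder := hasDerivAt_integral_of_contDiffOn (μ := volume) isOpen_Ioo
      (hΦ.mono (prod_mono (fun s (hs : s ∈ Ioo 0 T) => mem_Ici.2 hs.1.le) Subset.rfl))
      (isCompact_closedBall (0 : E3) (R + σ * T))
      (fun s hs x hx => hzero T s hs.1.le hs.2.le x hx) ⟨hs, hsT⟩
    have hIci : Ici (0 : ℝ) ∈ 𝓝 s := Ici_mem_nhds hs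
    have hs' : s ∈ Ici (0 : ℝ) := hs.le
    -- `∂ₜ(ρ - ρ̄) = -div (ρ u)` pointwise, and the divergence integrates to zero
    have hpt : ∀ x, deriv (fun r => ρ r x - ρbar) s = -divergence (fun y => ρ s y • u s y) x := by
      intro x
      rw [((hasDerivAt_timeLine_timeDerivWithin h.contDiffOn_density hIci x).sub_const ρbar).deriv]
      linarith [h.mass s hs' x]
    have hρs : ContDiff ℝ 1 (ρ s) := contDiff_slice_of_contDiffOn h.contDiffOn_density hs'
    have hus : ContDiff ℝ 1 (u s) := contDiff_slice_of_contDiffOn h.contDiffOn_velocity hs'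
    have hcs : HasCompactSupport fun y => ρ s y • u s y := by
      refine HasCompactSupport.intro (isCompact_closedBall (0 : E3) (R + σ * T)) fun x hx => ?_
      rw [(rest_of_notMem_closedBall hσ hrest hs.le hsT.le hx).2.1, smul_zero]
    have hint : ∫ x, deriv (fun r => ρ r x - ρbar) s = 0 := by
      rw [integral_congr_ae (Eventually.of_forall hpt), integral_neg,
        integral_divergence_eq_zero (w := fun y => ρ s y • u s y) (hρs.smul hus) hcs, neg_zero]
    rw [hint] at hder
    exact hder

/-! ### (2.1b) conservation of the entropy-weighted mass excess -/

/-- **(2.1b)** `η(t) = η(0)`: `∫ (ρ e^{S/γ} - ρ̄ e^{S̄/γ})` is conserved for a `C¹` solution at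
rest beyond the front (`∂ₜ(ρ e^{S/γ}) = -div (ρ e^{S/γ} u)` by (1.1 a) and (1.1 c)). [cite: Sideris1985, (2.1b)] -/
theorem entropyMassExcess_eq (h : IsPolytropicC1Solution A γ (Ici 0) ρ u S) (hγ : γ ≠ 0)
    (hσ : 0 ≤ σ)
    (hrest : ∀ t, 0 ≤ t → ∀ x : E3, R + σ * t ≤ ‖x‖ → ρ t x = ρbar ∧ u t x = 0 ∧ S t x = Sbar)
    {t : ℝ} (ht : 0 ≤ t) :
    entropyMassExcess γ ρbar Sbar ρ S t = entropyMassExcess γ ρbar Sbar ρ S 0 := by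
  have hΦ : ContDiffOn ℝ 1 (uncurry fun s (x : E3) =>
      ρ s x * Real.exp (S s x / γ) - ρbar * Real.exp (Sbar / γ)) (Ici 0 ×ˢ univ) :=
    (h.contDiffOn_density.mul (h.contDiffOn_entropy.div_const γ).exp).sub contDiffOn_const
  have hzero : ∀ T s, 0 ≤ s → s ≤ T → ∀ x ∉ closedBall (0 : E3) (R + σ * T),
      ρ s x * Real.exp (S s x / γ) - ρbar * Real.exp (Sbar / γ) = 0 := by
    intro T s hs hsT x hx
    obtain ⟨h1, -, h3⟩ := rest_of_notMem_closedBall hσ hrest hs hsT hx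
    rw [h1, h3, sub_self]
  refine eq_of_hasDerivAt_zero (f := entropyMassExcess γ ρbar Sbar ρ S) (fun T hT => ?_)
    (fun T s hs hsT => ?_) ht
  · exact continuousOn_integral_of_support_subset (μ := volume) (isCompact_closedBall 0 (R + σ * T))
      (hΦ.continuousOn.mono (prod_mono Icc_subset_Ici_self Subset.rfl))
      fun s hs x hx => hzero T s hs.1 hs.2 x hx
  · have hder := hasDerivAt_integral_of_contDiffOn (μ := volume) isOpen_Ioo
      (hΦ.mono (prod_mono (fun s (hs : s ∈ Ioo 0 T) => mem_Ici.2 hs.1.le) Subset.rfl))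
      (isCompact_closedBall (0 : E3) (R + σ * T))
      (fun s hs x hx => hzero T s hs.1.le hs.2.le x hx) ⟨hs, hsT⟩
    have hIci : Ici (0 : ℝ) ∈ 𝓝 s := Ici_mem_nhds hs
    have hs' : s ∈ Ici (0 : ℝ) := hs.le
    have hρs : ContDiff ℝ 1 (ρ s) := contDiff_slice_of_contDiffOn h.contDiffOn_density hs'
    have hus : ContDiff ℝ 1 (u s) := contDiff_slice_of_contDiffOn h.contDiffOn_velocity hs'
    have hSs : ContDiff ℝ 1 (S s) := contDiff_slice_of_contDiffOn h.contDiffOn_entropy hs'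
    -- the weighted density `θ = ρ e^{S/γ}` and its derivatives
    have hθs : ContDiff ℝ 1 fun y => ρ s y * Real.exp (S s y / γ) := hρs.mul (hSs.div_const γ).exp
    have hθd : ∀ x, HasFDerivAt (fun y => ρ s y * Real.exp (S s y / γ))
        (ρ s x • (Real.exp (S s x / γ) • (γ⁻¹ • fderiv ℝ (S s) x)) +
          Real.exp (S s x / γ) • fderiv ℝ (ρ s) x) x := by
      intro x
      have hS1 : HasFDerivAt (fun y => S s y / γ) (γ⁻¹ • fderiv ℝ (S s) x) x := by
        have := ((hSs.differentiable one_ne_zero x).hasFDerivAt).mul_const γ⁻¹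
        simpa [div_eq_mul_inv] using this
      exact ((hρs.differentiable one_ne_zero x).hasFDerivAt).mul hS1.exp
    have hpt : ∀ x, deriv (fun r => ρ r x * Real.exp (S r x / γ) - ρbar * Real.exp (Sbar / γ)) s =
        -divergence (fun y => (ρ s y * Real.exp (S s y / γ)) • u s y) x := by
      intro x
      have hρt := hasDerivAt_timeLine_timeDerivWithin h.contDiffOn_density hIci x
      have hSt := hasDerivAt_timeLine_timeDerivWithin h.contDiffOn_entropy hIci x
      have hline : HasDerivAt (fun r => ρ r x * Real.exp (S r x / γ) - ρbar * Real.exp (Sbar / γ))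
          (timeDerivWithin (Ici 0) ρ s x * Real.exp (S s x / γ) +
            ρ s x * (Real.exp (S s x / γ) * (timeDerivWithin (Ici 0) S s x / γ))) s :=
        (hρt.mul (hSt.div_const γ).exp).sub_const _
      rw [hline.deriv]
      -- the two divergences and the two equations
      have hmass := h.mass s hs' x
      have hent := h.entropy s hs' x
      rw [divergence_smul_apply (hρs.differentiable one_ne_zero x)
        (hus.differentiable one_ne_zero x), gradient, real_inner_comm,
        InnerProductSpace.toDual_symm_apply] at hmass
      rw [divergence_smul_apply (hθs.differentiable one_ne_zero x)
        (hus.differentiable one_ne_zero x), gradient, real_inner_comm,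
        InnerProductSpace.toDual_symm_apply, (hθd x).fderiv]
      simp only [convect] at hent
      simp only [_root_.add_apply, _root_.FunLike.coe_smul, Pi.smul_apply, smul_eq_mul]
      have e1 : timeDerivWithin (Ici 0) ρ s x =
          -(ρ s x * divergence (u s) x + fderiv ℝ (ρ s) x (u s x)) := by linarith
      have e2 : timeDerivWithin (Ici 0) S s x = -(fderiv ℝ (S s) x (u s x)) := by linarith
      rw [e1, e2]
      field_simp
      ring
    have hcs : HasCompactSupport fun y => (ρ s y * Real.exp (S s y / γ)) • u s y := by
      refine HasCompactSupport.intro (isCompact_closedBall (0 : E3) (R + σ * T)) fun x hx => ?_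
      rw [(rest_of_notMem_closedBall hσ hrest hs.le hsT.le hx).2.1, smul_zero]
    have hint : ∫ x, deriv (fun r => ρ r x * Real.exp (S r x / γ) -
        ρbar * Real.exp (Sbar / γ)) s = 0 := by
      rw [integral_congr_ae (Eventually.of_forall hpt), integral_neg,
        integral_divergence_eq_zero (w := fun y => (ρ s y * Real.exp (S s y / γ)) • u s y)
          (hθs.smul hus) hcs, neg_zero]
    rw [hint] at hder
    exact hder

/-! ### (2.1c) the radial momentum -/

/-- The divergence of the position field is the dimension: `div x = 3` on `ℝ³`. [folklore] -/
theorem divergence_position (x : E3) : divergence (fun y : E3 => y) x = 3 := by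
  have h1 : (fun y : E3 => y) = id := rfl
  rw [VectorCalculus.divergence, h1, fderiv_id, ContinuousLinearMap.coe_id, LinearMap.trace_id,
    finrank_euclideanSpace_fin]
  norm_num

/-- The integrand `ρ ⟪x, u⟫` of `F` is jointly `C¹` on `[0, ∞) × ℝ³`. [folklore] -/
theorem contDiffOn_radialIntegrand (h : IsPolytropicC1Solution A γ (Ici 0) ρ u S) :
    ContDiffOn ℝ 1 (uncurry fun s (x : E3) => ρ s x * ⟪x, u s x⟫) (Ici 0 ×ˢ univ) :=
  h.contDiffOn_density.mul (contDiffOn_snd.inner ℝ h.contDiffOn_velocity)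

/-- **Continuity of `F`** on `[0, T]` for a `C¹` solution at rest beyond the front. [cite: Sideris1985, (1.4c)] -/
theorem continuousOn_radialMomentum (h : IsPolytropicC1Solution A γ (Ici 0) ρ u S) (hσ : 0 ≤ σ)
    (hrest : ∀ t, 0 ≤ t → ∀ x : E3, R + σ * t ≤ ‖x‖ → ρ t x = ρbar ∧ u t x = 0 ∧ S t x = Sbar)
    (T : ℝ) : ContinuousOn (radialMomentum ρ u) (Icc 0 T) :=
  continuousOn_integral_of_support_subset (μ := volume) (isCompact_closedBall 0 (R + σ * T))
    ((contDiffOn_radialIntegrand h).continuousOn.mono (prod_mono Icc_subset_Ici_self Subset.rfl))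
    fun s hs x hx => by
      simp [(rest_of_notMem_closedBall hσ hrest hs.1 hs.2 hx).2.1]

/-- **(2.1c)** `F'(t) = ∫ (ρ ‖u‖² + 3 (p - p̄)) dx` for `t > 0`: differentiate `F = ∫ ρ ⟪x, u⟫`
under the integral sign, insert (1.1 a, b) (`∂ₜ(ρ⟪x, u⟫) = -div(ρu)⟪x, u⟫ - ρ⟪x, (u·∇)u⟫ - ⟪x, ∇p⟫`),
and integrate by parts: `∫ ⟪x, u⟫ div(ρu) = -∫ (ρ ⟪x, (u·∇)u⟫ + ρ‖u‖²)` and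
`∫ ⟪x, ∇(p - p̄)⟫ = -∫ (p - p̄) div x = -3 ∫ (p - p̄)` (Sideris §2, "using the proposition and
integration by parts"). [cite: Sideris1985, (2.1c)] -/
theorem hasDerivAt_radialMomentum (h : IsPolytropicC1Solution A γ (Ici 0) ρ u S) (hσ : 0 ≤ σ)
    (hrest : ∀ t, 0 ≤ t → ∀ x : E3, R + σ * t ≤ ‖x‖ → ρ t x = ρbar ∧ u t x = 0 ∧ S t x = Sbar)
    {t : ℝ} (ht : 0 < t) :
    HasDerivAt (radialMomentum ρ u)
      ((∫ x, ρ t x * ‖u t x‖ ^ 2) +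
        3 * ∫ x, (polytropicPressure A γ (ρ t x) (S t x) - polytropicPressure A γ ρbar Sbar)) t := by
  have ht' : t ∈ Ici (0 : ℝ) := ht.le
  have hIci : Ici (0 : ℝ) ∈ 𝓝 t := Ici_mem_nhds ht
  set T := t + 1 with hT
  set K : Set E3 := closedBall (0 : E3) (R + σ * T) with hK
  have hrestK : ∀ x ∉ K, ρ t x = ρbar ∧ u t x = 0 ∧ S t x = Sbar := fun x hx =>
    rest_of_notMem_closedBall hσ hrest ht.le (by linarith) hx
  -- differentiation under the integral sign
  have hder := hasDerivAt_integral_of_contDiffOn (μ := volume) isOpen_Ioo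
    ((contDiffOn_radialIntegrand h).mono
      (prod_mono (fun s (hs : s ∈ Ioo 0 T) => mem_Ici.2 hs.1.le) Subset.rfl))
    (isCompact_closedBall (0 : E3) (R + σ * T))
    (fun s hs x hx => by simp [(rest_of_notMem_closedBall hσ hrest hs.1.le hs.2.le hx).2.1])
    (show t ∈ Ioo 0 T from ⟨ht, by linarith⟩)
  refine hder.congr_deriv ?_
  -- slices
  have hρs : ContDiff ℝ 1 (ρ t) := contDiff_slice_of_contDiffOn h.contDiffOn_density ht'
  have hus : ContDiff ℝ 1 (u t) := contDiff_slice_of_contDiffOn h.contDiffOn_velocity ht'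
  have hPs : ContDiff ℝ 1 (fun y => polytropicPressure A γ (ρ t y) (S t y)) :=
    contDiff_slice_of_contDiffOn (w := fun s y => polytropicPressure A γ (ρ s y) (S s y))
      h.contDiffOn_pressure ht'
  have hud : ∀ y, DifferentiableAt ℝ (u t) y := fun y => hus.differentiable one_ne_zero y
  have hρd : ∀ y, DifferentiableAt ℝ (ρ t) y := fun y => hρs.differentiable one_ne_zero y
  -- the pointwise time derivative of the integrand
  set d : E3 → ℝ := fun x => divergence (fun y => ρ t y • u t y) x with hd_def
  set gP : E3 → E3 := gradient (fun y => polytropicPressure A γ (ρ t y) (S t y)) with hgP_def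
  have hpt : ∀ x, deriv (fun s => ρ s x * ⟪x, u s x⟫) t =
      -(⟪x, u t x⟫ * d x) - ρ t x * ⟪x, fderiv ℝ (u t) x (u t x)⟫ - ⟪x, gP x⟫ := by
    intro x
    have hρt := hasDerivAt_timeLine_timeDerivWithin h.contDiffOn_density hIci x
    have hut := hasDerivAt_timeLine_timeDerivWithin h.contDiffOn_velocity hIci x
    have hin : HasDerivAt (fun s => ⟪x, u s x⟫) ⟪x, timeDerivWithin (Ici 0) u t x⟫ t := by
      simpa using (hasDerivAt_const t x).inner ℝ hut
    have hprod : HasDerivAt (fun s => ρ s x * ⟪x, u s x⟫)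
        (timeDerivWithin (Ici 0) ρ t x * ⟪x, u t x⟫ +
          ρ t x * ⟪x, timeDerivWithin (Ici 0) u t x⟫) t := hρt.mul hin
    rw [hprod.deriv]
    have hmass := h.mass t ht' x
    have hmom := congrArg (fun w => ⟪x, w⟫) (h.momentum t ht' x)
    simp only [inner_add_right, inner_smul_right, inner_zero_right, convect] at hmom
    have e1 : timeDerivWithin (Ici 0) ρ t x = -d x := by simp only [hd_def]; linarith
    rw [e1]
    simp only [hgP_def]
    linarith
  -- integrability of the pieces (continuous, supported in `K`)
  have hd_cont : Continuous d := continuous_divergence ((hρs.smul hus).continuous_fderiv one_ne_zero)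
  have hgP_cont : Continuous gP := continuous_gradient_of_contDiff hPs
  have hgP_zero : ∀ x ∉ K, gP x = 0 := by
    intro x hx
    have hKc : IsClosed K := isClosed_closedBall
    have hev : (fun y => polytropicPressure A γ (ρ t y) (S t y)) =ᶠ[𝓝 x]
        fun _ => polytropicPressure A γ ρbar Sbar := by
      filter_upwards [hKc.isOpen_compl.mem_nhds hx] with y hy
      rw [(hrestK y hy).1, (hrestK y hy).2.2]
    have hf0 : fderiv ℝ (fun y => polytropicPressure A γ (ρ t y) (S t y)) x = 0 := by
      rw [hev.fderiv_eq]
      exact (hasFDerivAt_const _ x).fderiv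
    simp only [hgP_def, gradient, hf0, map_zero]
  have integrable_of : ∀ {f : E3 → ℝ}, Continuous f → (∀ y, y ∉ K → f y = 0) → Integrable f :=
    fun hf hz => hf.integrable_of_hasCompactSupport
      (HasCompactSupport.intro (isCompact_closedBall (0 : E3) (R + σ * T)) hz)
  have hI1 : Integrable fun x => ⟪x, u t x⟫ * d x :=
    integrable_of ((continuous_id.inner hus.continuous).mul hd_cont)
      fun y hy => by simp [(hrestK y hy).2.1]
  have hI2 : Integrable fun x => ρ t x * ⟪x, fderiv ℝ (u t) x (u t x)⟫ :=
    integrable_of (hρs.continuous.mul (continuous_id.inner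
      ((hus.continuous_fderiv one_ne_zero).clm_apply hus.continuous)))
      fun y hy => by simp [(hrestK y hy).2.1]
  have hI3 : Integrable fun x => ⟪x, gP x⟫ :=
    integrable_of (continuous_id.inner hgP_cont) fun y hy => by simp [hgP_zero y hy]
  have hI4 : Integrable fun x => ρ t x * ‖u t x‖ ^ 2 :=
    integrable_of (hρs.continuous.mul (hus.continuous.norm.pow 2))
      fun y hy => by simp [(hrestK y hy).2.1]
  -- first integration by parts: `∫ ⟪x, u⟫ div(ρu) = -∫ (ρ⟪x, Du u⟫ + ρ‖u‖²)`
  have hcW : HasCompactSupport fun y => ρ t y • u t y :=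
    HasCompactSupport.intro (isCompact_closedBall (0 : E3) (R + σ * T)) fun y hy => by
      simp [(hrestK y hy).2.1]
  have hIBP1 : ∫ x, ⟪x, u t x⟫ * d x =
      -∫ x, (ρ t x * ⟪x, fderiv ℝ (u t) x (u t x)⟫ + ρ t x * ‖u t x‖ ^ 2) := by
    have h1 := integral_mul_divergence_add_eq_zero_right (θ := fun y : E3 => ⟪y, u t y⟫)
      (u := fun y => ρ t y • u t y) (contDiff_id.inner ℝ hus) (hρs.smul hus) hcW
    have h2 : ∀ x, ⟪ρ t x • u t x, gradient (fun y : E3 => ⟪y, u t y⟫) x⟫ =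
        ρ t x * ⟪x, fderiv ℝ (u t) x (u t x)⟫ + ρ t x * ‖u t x‖ ^ 2 := by
      intro x
      rw [gradient, real_inner_comm, InnerProductSpace.toDual_symm_apply,
        fderiv_inner_apply ℝ (f := fun y : E3 => y) differentiableAt_id (hud x), fderiv_fun_id]
      simp only [ContinuousLinearMap.coe_id', id_eq, map_smul, inner_smul_right, inner_smul_left,
        RCLike.conj_to_real, real_inner_self_eq_norm_sq]
    simp_rw [h2] at h1
    have h1' : (∫ x, ⟪x, u t x⟫ * d x) +
        ∫ x, (ρ t x * ⟪x, fderiv ℝ (u t) x (u t x)⟫ + ρ t x * ‖u t x‖ ^ 2) = 0 := h1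
    linarith
  -- second integration by parts: `∫ ⟪x, ∇p⟫ = -3 ∫ (p - p̄)`
  have hcP : HasCompactSupport fun y =>
      polytropicPressure A γ (ρ t y) (S t y) - polytropicPressure A γ ρbar Sbar :=
    HasCompactSupport.intro (isCompact_closedBall (0 : E3) (R + σ * T)) fun y hy => by
      rw [(hrestK y hy).1, (hrestK y hy).2.2, sub_self]
  have hIBP2 : ∫ x, ⟪x, gP x⟫ =
      -(3 * ∫ x, (polytropicPressure A γ (ρ t x) (S t x) - polytropicPressure A γ ρbar Sbar)) := by
    have h1 := integral_mul_divergence_add_eq_zero_left (u := fun y : E3 => y)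
      (hPs.sub contDiff_const) contDiff_id hcP
    have h2 : ∀ x, gradient (fun y => polytropicPressure A γ (ρ t y) (S t y) -
        polytropicPressure A γ ρbar Sbar) x = gP x := by
      intro x
      simp only [hgP_def, gradient, fderiv_sub_const]
    simp_rw [divergence_position, h2] at h1
    rw [integral_mul_const] at h1
    linarith
  -- assemble
  calc ∫ x, deriv (fun s => ρ s x * ⟪x, u s x⟫) t
      = ∫ x, (-(⟪x, u t x⟫ * d x) - ρ t x * ⟪x, fderiv ℝ (u t) x (u t x)⟫ - ⟪x, gP x⟫) :=
        integral_congr_ae (Eventually.of_forall hpt)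
    _ = -(∫ x, ⟪x, u t x⟫ * d x) - (∫ x, ρ t x * ⟪x, fderiv ℝ (u t) x (u t x)⟫) - ∫ x, ⟪x, gP x⟫ := by
        rw [integral_sub (f := fun x => -(⟪x, u t x⟫ * d x) -
            ρ t x * ⟪x, fderiv ℝ (u t) x (u t x)⟫) (g := fun x => ⟪x, gP x⟫) (hI1.neg.sub hI2) hI3,
          integral_sub (f := fun x => -(⟪x, u t x⟫ * d x))
            (g := fun x => ρ t x * ⟪x, fderiv ℝ (u t) x (u t x)⟫) hI1.neg hI2, integral_neg]
    _ = (∫ x, ρ t x * ‖u t x‖ ^ 2) +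
        3 * ∫ x, (polytropicPressure A γ (ρ t x) (S t x) - polytropicPressure A γ ρbar Sbar) := by
        rw [hIBP1, hIBP2, integral_add hI2 hI4]
        ring

end Identities

end Literature.Barriers.AtomisticToContinuum.PolytropicEuler

end
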